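import Summits.ValiantsHypothesis.ValiantsHypothesis.Theorems.KPlusLogSqLawHullFacts

/-!
# KPlusLogSqLaw — hull fact N7 «free-part domination» (kernel theorems; conjb-2 g20)

Continuation of `KPlusLogSqLawHullFacts` (N2, N4, N5).  Same kinetic setting: weights `a e + lam e * t`, a chain of
optimal sets, breakpoints in increasing time; at a breakpoint the two consecutive optima have equal objective and every
competitor has objective `≤` theirs; a set alive strictly between two breakpoints is optimal at both.  Nothing about
matchings is used: «competitor» is whatever set the user certifies as admissible by supplying the inequality.

For a set of edges `S` and a state `μ`, the *signed `S`-sum* `∑_{e ∈ S} (±)(a e + lam e * t)` (sign `−` on `e ∈ μ`,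
`+` otherwise) is the gain of flipping `S` at `μ`; it is affine in `t` with slope `σ = ∑_{e ∈ S} (±) lam e` and depends on
`μ` only through the membership pattern of `S` in `μ`.

* `vertex_certificate_later` (N7/K1, forward): if `μ₀` is optimal at time `t₀` against the competitor `μ₀ ∆ S` (so the
  signed `S`-sum is `≤ 0` at `t₀`) and `σ < 0`, then at any later breakpoint `t > t₀` no optimal `μ` with THE SAME pattern on
  `S` can flip a block `B ⊇ S` whose remainder competitor `μ ∆ (B \ S)` is admissible: the remainder would gain `−(S-sum) > 0`.
* `vertex_certificate_earlier` (N7/K1, backward): the mirror statement for `σ > 0` and an earlier breakpoint `t < t₀`.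
* `vertex_dominated_later` / `vertex_dominated_earlier` (N7/K2): under the same certificate, no set `μ` that is optimal
  at a later (resp. earlier) time can show the REVERSED pattern on `S` with `μ ∆ S` admissible: flipping `S` would gain.

These four, with `undo_lemma` (whose certificate comes from a co-flipped block instead of a vertex), are the complete
list of pruning rules of the located engine `n7.py`; they are necessary conditions for realisability valid for every
speed alphabet.  Located (THEORY-NOTE-g20 §1n): together with N2/N4 they leave no abstract violator of the parity law for
speeds `{±1,±2}` (N ≤ 14 exhaustive, N ≤ 18 targeted) and they isolate the genuine `{±1,±3}` counterexample of
`KPlusLogSqLawTwoSpeed13Counterexample` as one of 4 survivors among 83 411 candidates.  No definitions.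
-/

namespace Summit.ValiantsHypothesis.ValiantsHypothesis.Theorems.KPlusLogSqLawFreePart

open Finset
open scoped symmDiff
open Summit.ValiantsHypothesis.ValiantsHypothesis.Theorems.KPlusLogSqLawHullFacts

variable {ι : Type*} [DecidableEq ι]

/-- the signed `S`-sum depends on the state only through the membership pattern on `S` -/
theorem part_congr (a lam : ι → ℚ) {μ₀ μ S : Finset ι} (hpat : ∀ e ∈ S, (e ∈ μ ↔ e ∈ μ₀)) (t : ℚ) :
    ∑ e ∈ S, (if e ∈ μ then (-1 : ℚ) else 1) * (a e + lam e * t)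
      = ∑ e ∈ S, (if e ∈ μ₀ then (-1 : ℚ) else 1) * (a e + lam e * t) := by
  refine Finset.sum_congr rfl fun e he => ?_
  by_cases h : e ∈ μ₀
  · have h' : e ∈ μ := (hpat e he).mpr h
    simp [h, h']
  · have h' : e ∉ μ := fun hm => h ((hpat e he).mp hm)
    simp [h, h']

/-- **N7/K1 forward.**  Vertex certificate at `t₀` (competitor `μ₀ ∆ S` not better), negative slope; at a later breakpoint
`t` an optimal `μ` with the same pattern on `S` flips `B ⊇ S` (equal objectives) while the remainder competitor
`μ ∆ (B \ S)` is not better.  Impossible. -/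
theorem vertex_certificate_later (a lam : ι → ℚ) {t₀ t : ℚ} (ht : t₀ < t) {μ₀ μ S B : Finset ι}
    (h₀ : ∑ e ∈ μ₀ ∆ S, (a e + lam e * t₀) ≤ ∑ e ∈ μ₀, (a e + lam e * t₀))
    (hσ : ∑ e ∈ S, (if e ∈ μ₀ then (-1 : ℚ) else 1) * lam e < 0)
    (hpat : ∀ e ∈ S, (e ∈ μ ↔ e ∈ μ₀)) (hS : S ⊆ B)
    (h₁ : ∑ e ∈ μ ∆ B, (a e + lam e * t) = ∑ e ∈ μ, (a e + lam e * t))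
    (h₁R : ∑ e ∈ μ ∆ (B \ S), (a e + lam e * t) ≤ ∑ e ∈ μ, (a e + lam e * t)) : False := by
  have g₀ := gain_eq a lam μ₀ S t₀
  have p₀ : ∑ e ∈ S, (if e ∈ μ₀ then (-1 : ℚ) else 1) * (a e + lam e * t₀) ≤ 0 := by linarith
  have lin := part_linear a lam μ₀ S t t₀
  have hneg : (∑ e ∈ S, (if e ∈ μ₀ then (-1 : ℚ) else 1) * lam e) * (t - t₀) < 0 :=
    mul_neg_of_neg_of_pos hσ (sub_pos.mpr ht)
  have p₁ : ∑ e ∈ S, (if e ∈ μ₀ then (-1 : ℚ) else 1) * (a e + lam e * t) < 0 := by linarith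
  have c := part_congr a lam hpat t
  have g₁ := gain_eq a lam μ B t
  have g₁R := gain_eq a lam μ (B \ S) t
  have s₁ := part_add a lam μ hS t
  linarith

/-- **N7/K1 backward.**  Vertex certificate at `t₀`, positive slope; at an EARLIER breakpoint `t < t₀` an optimal `μ` with
the same pattern on `S` flips `B ⊇ S` while the remainder competitor is not better.  Impossible. -/
theorem vertex_certificate_earlier (a lam : ι → ℚ) {t₀ t : ℚ} (ht : t < t₀) {μ₀ μ S B : Finset ι}
    (h₀ : ∑ e ∈ μ₀ ∆ S, (a e + lam e * t₀) ≤ ∑ e ∈ μ₀, (a e + lam e * t₀))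
    (hσ : 0 < ∑ e ∈ S, (if e ∈ μ₀ then (-1 : ℚ) else 1) * lam e)
    (hpat : ∀ e ∈ S, (e ∈ μ ↔ e ∈ μ₀)) (hS : S ⊆ B)
    (h₁ : ∑ e ∈ μ ∆ B, (a e + lam e * t) = ∑ e ∈ μ, (a e + lam e * t))
    (h₁R : ∑ e ∈ μ ∆ (B \ S), (a e + lam e * t) ≤ ∑ e ∈ μ, (a e + lam e * t)) : False := by
  have g₀ := gain_eq a lam μ₀ S t₀
  have p₀ : ∑ e ∈ S, (if e ∈ μ₀ then (-1 : ℚ) else 1) * (a e + lam e * t₀) ≤ 0 := by linarith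
  have lin := part_linear a lam μ₀ S t t₀
  have hneg : (∑ e ∈ S, (if e ∈ μ₀ then (-1 : ℚ) else 1) * lam e) * (t - t₀) < 0 :=
    mul_neg_of_pos_of_neg hσ (sub_neg.mpr ht)
  have p₁ : ∑ e ∈ S, (if e ∈ μ₀ then (-1 : ℚ) else 1) * (a e + lam e * t) < 0 := by linarith
  have c := part_congr a lam hpat t
  have g₁ := gain_eq a lam μ B t
  have g₁R := gain_eq a lam μ (B \ S) t
  have s₁ := part_add a lam μ hS t
  linarith

/-- **N7/K2 forward.**  Vertex certificate at `t₀`, negative slope; a set `μ` optimal at a later time `t` against the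
competitor `μ ∆ S` cannot show the reversed pattern on `S`: flipping `S` there gains `−(signed S-sum) > 0`. -/
theorem vertex_dominated_later (a lam : ι → ℚ) {t₀ t : ℚ} (ht : t₀ < t) {μ₀ μ S : Finset ι}
    (h₀ : ∑ e ∈ μ₀ ∆ S, (a e + lam e * t₀) ≤ ∑ e ∈ μ₀, (a e + lam e * t₀))
    (hσ : ∑ e ∈ S, (if e ∈ μ₀ then (-1 : ℚ) else 1) * lam e < 0)
    (hrev : ∀ e ∈ S, (e ∈ μ ↔ e ∉ μ₀))
    (h₁ : ∑ e ∈ μ ∆ S, (a e + lam e * t) ≤ ∑ e ∈ μ, (a e + lam e * t)) : False := by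
  have g₀ := gain_eq a lam μ₀ S t₀
  have p₀ : ∑ e ∈ S, (if e ∈ μ₀ then (-1 : ℚ) else 1) * (a e + lam e * t₀) ≤ 0 := by linarith
  have lin := part_linear a lam μ₀ S t t₀
  have hneg : (∑ e ∈ S, (if e ∈ μ₀ then (-1 : ℚ) else 1) * lam e) * (t - t₀) < 0 :=
    mul_neg_of_neg_of_pos hσ (sub_pos.mpr ht)
  have p₁ : ∑ e ∈ S, (if e ∈ μ₀ then (-1 : ℚ) else 1) * (a e + lam e * t) < 0 := by linarith
  have r := part_rev a lam hrev t
  have g₁ := gain_eq a lam μ S t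
  linarith

/-- **N7/K2 backward.**  Vertex certificate at `t₀`, positive slope; a set `μ` optimal at an earlier time `t < t₀` against
`μ ∆ S` cannot show the reversed pattern on `S`. -/
theorem vertex_dominated_earlier (a lam : ι → ℚ) {t₀ t : ℚ} (ht : t < t₀) {μ₀ μ S : Finset ι}
    (h₀ : ∑ e ∈ μ₀ ∆ S, (a e + lam e * t₀) ≤ ∑ e ∈ μ₀, (a e + lam e * t₀))
    (hσ : 0 < ∑ e ∈ S, (if e ∈ μ₀ then (-1 : ℚ) else 1) * lam e)
    (hrev : ∀ e ∈ S, (e ∈ μ ↔ e ∉ μ₀))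
    (h₁ : ∑ e ∈ μ ∆ S, (a e + lam e * t) ≤ ∑ e ∈ μ, (a e + lam e * t)) : False := by
  have g₀ := gain_eq a lam μ₀ S t₀
  have p₀ : ∑ e ∈ S, (if e ∈ μ₀ then (-1 : ℚ) else 1) * (a e + lam e * t₀) ≤ 0 := by linarith
  have lin := part_linear a lam μ₀ S t t₀
  have hneg : (∑ e ∈ S, (if e ∈ μ₀ then (-1 : ℚ) else 1) * lam e) * (t - t₀) < 0 :=
    mul_neg_of_pos_of_neg hσ (sub_neg.mpr ht)
  have p₁ : ∑ e ∈ S, (if e ∈ μ₀ then (-1 : ℚ) else 1) * (a e + lam e * t) < 0 := by linarith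
  have r := part_rev a lam hrev t
  have g₁ := gain_eq a lam μ S t
  linarith

end Summit.ValiantsHypothesis.ValiantsHypothesis.Theorems.KPlusLogSqLawFreePart
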